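import Summits.ValiantsHypothesis.ValiantsHypothesis.Theorems.BarrierLeverChowHitsPartitionMinorsRStarvedNormalForm
import Summits.ValiantsHypothesis.ValiantsHypothesis.Theorems.BarrierLeverPartitionMinorsHitByVPBiadditiveDoor

/-!
# Route BarrierLever — item `ChowHitsPartitionMinorsR` (stmt-ValiantsHypothesis-21882), STARVED DESIGN IV:
# the design tables and the coefficient calculus of its row polynomials

Helper file (`--supports stmt-ValiantsHypothesis-21882`; cell valiant-natproofs, rung V4, 𝒟-side; prover seat val-np-p5
gen 31). Closes NO item. Fourth file of the kernel chain for THEOREM A′ of memo MEMO-21882-valnp5-g31.md §3/§5 (K-A3b-1).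

THE STARVED DESIGN (all parameters `= 1`). Columns `w : Fin r → Finset (Fin h)`; the forms are indexed by
`ι = Fin h ⊕ {j // (w j).card = 3}`: a VERTEX form `1 + x_a + y_a` for every `a`, and for every 3-column `j` a PAIR form
`1 + (x_{α j} + x_{β j}) + Σ_{c ∈ w j} y_c` (`{α j, β j}` is the non-edge matched with the triangle `w j`). Coefficient
tables `desA`, `desB`; `y`-parts `linY desB (inl a) = y_a`, `linY desB (inr j) = Y_{w j}`.

COEFFICIENT CALCULUS at `x`-free exponents `E ∅ W` (only `|W| ≤ 3` matters):
* `coeff_linY_pow`: `coeff (E ∅ W) (N_b)^m = [|W| = m] · m! · ∏_{c∈W} b c` for a linear `y`-form `N_b = Σ_c b_c y_c`;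
* `coeff_tinv`: `coeff (E ∅ W) t_k = (−1)^{|W|} |W|! ∏_{c∈W} B k c` (`|W| ≤ 3`);
* `coeff_rho1_des`: for the design, `coeff (E ∅ W) (ρ̂₁ v) = (−1)^{|W|} |W|! · ([W ⊆ {v}] + inc v W)` with
  `inc v W = #{j : v ∈ {α j, β j}, W ⊆ w j}` (`|W| ≤ 3`);
* `coeff_mul_empty`: the squarefree convolution `coeff (E ∅ W) (f g) = Σ_{T ⊆ W} coeff (E ∅ T) f · coeff (E ∅ (W∖T)) g`
  (`BiadditiveDoor.coeff_partitionExpo_mul`).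

WHAT THIS IS NOT: no determinant yet (K-A3b-2/3); nothing on crux stmt-ValiantsHypothesis-14610 or on `VP` versus `VNP`.
-/

set_option linter.dupNamespace false

namespace Summit.ValiantsHypothesis.ValiantsHypothesis.Theorems.BarrierLever.ChowStarvedDesign

open Finset MvPolynomial
open Summit.ValiantsHypothesis.ValiantsHypothesis.Theorems.BarrierLever.BiadditiveDoor (coeff_partitionExpo_mul)

noncomputable section

variable {h r : ℕ}

/-! ## 1. Coefficient calculus for linear `y`-forms and truncated inverses -/

/-- Squarefree convolution at an `x`-free exponent. -/
theorem coeff_mul_empty (f g : MvPolynomial (Fin (h + h)) ℂ) (W : Finset (Fin h)) :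
    coeff (∑ a ∈ (∅ : Finset (Fin h)), Finsupp.single (Fin.castAdd h a) 1 +
        ∑ c ∈ W, Finsupp.single (Fin.natAdd h c) 1) (f * g) =
      ∑ T ∈ W.powerset, coeff (∑ a ∈ (∅ : Finset (Fin h)), Finsupp.single (Fin.castAdd h a) 1 +
          ∑ c ∈ T, Finsupp.single (Fin.natAdd h c) 1) f *
        coeff (∑ a ∈ (∅ : Finset (Fin h)), Finsupp.single (Fin.castAdd h a) 1 +
          ∑ c ∈ W \ T, Finsupp.single (Fin.natAdd h c) 1) g := by
  rw [coeff_partitionExpo_mul, Finset.powerset_empty, Finset.sum_singleton]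
  rfl

/-- **Powers of a linear `y`-form**: `coeff (E ∅ W) (Σ_c b_c y_c)^m = [|W| = m] · m! · ∏_{c∈W} b_c`. -/
theorem coeff_linY_pow (b : Fin h → ℂ) (m : ℕ) :
    ∀ W : Finset (Fin h), coeff (∑ a ∈ (∅ : Finset (Fin h)), Finsupp.single (Fin.castAdd h a) 1 +
        ∑ c ∈ W, Finsupp.single (Fin.natAdd h c) 1) ((∑ c, C (b c) * X (Fin.natAdd h c)) ^ m) =
      if W.card = m then (m.factorial : ℂ) * ∏ c ∈ W, b c else 0 := by
  classical
  induction m with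
  | zero =>
    intro W
    rw [pow_zero, coeff_one]
    by_cases hW : W = ∅
    · subst hW
      simp
    · rw [if_neg, if_neg]
      · intro hc
        exact hW (Finset.card_eq_zero.mp hc)
      · intro h0
        obtain ⟨c, hc⟩ := Finset.nonempty_iff_ne_empty.mpr hW
        have h1 := congrArg (fun v : Fin (h + h) →₀ ℕ => v (Fin.natAdd h c)) h0
        simp only [Finsupp.coe_zero, Pi.zero_apply, ProductStateSums.partitionExpo_apply_natAdd] at h1
        rw [if_pos hc] at h1
        exact one_ne_zero h1.symm
  | succ m ih =>
    intro W
    rw [pow_succ, ← one_mul ((∑ c, C (b c) * X (Fin.natAdd h c)) ^ m), mul_assoc, one_mul,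
      coeff_partitionExpo_mul_linY]
    simp_rw [ih]
    by_cases hW : W.card = m + 1
    · rw [if_pos hW]
      have hWm : ∀ c ∈ W, (W.erase c).card = m := fun c hc => by
        rw [Finset.card_erase_of_mem hc]; omega
      have hterm : ∀ c ∈ W, b c * (if (W.erase c).card = m then (m.factorial : ℂ) * ∏ x ∈ W.erase c, b x else 0) =
          (m.factorial : ℂ) * ∏ x ∈ W, b x := by
        intro c hc
        rw [if_pos (hWm c hc), ← Finset.mul_prod_erase W b hc]
        ring
      rw [Finset.sum_congr rfl hterm, Finset.sum_const, nsmul_eq_mul, hW, Nat.factorial_succ, Nat.cast_mul]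
      push_cast
      ring
    · rw [if_neg hW]
      refine Finset.sum_eq_zero fun c hc => ?_
      rw [if_neg, mul_zero]
      rw [Finset.card_erase_of_mem hc]
      have := Finset.card_pos.mpr ⟨c, hc⟩
      omega

/-- **Coefficients of a truncated inverse**: for `|W| ≤ 3`,
`coeff (E ∅ W) (1 − N + N² − N³) = (−1)^{|W|} · |W|! · ∏_{c∈W} b_c`. -/
theorem coeff_tinv_lin (b : Fin h → ℂ) (W : Finset (Fin h)) (hW : W.card ≤ 3) :
    coeff (∑ a ∈ (∅ : Finset (Fin h)), Finsupp.single (Fin.castAdd h a) 1 +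
        ∑ c ∈ W, Finsupp.single (Fin.natAdd h c) 1)
        (1 - (∑ c, C (b c) * X (Fin.natAdd h c)) + (∑ c, C (b c) * X (Fin.natAdd h c)) ^ 2 -
          (∑ c, C (b c) * X (Fin.natAdd h c)) ^ 3) =
      (-1) ^ W.card * (W.card.factorial : ℂ) * ∏ c ∈ W, b c := by
  have e1 : (1 : MvPolynomial (Fin (h + h)) ℂ) = (∑ c, C (b c) * X (Fin.natAdd h c)) ^ 0 := (pow_zero _).symm
  have e2 : (∑ c, C (b c) * X (Fin.natAdd h c) : MvPolynomial (Fin (h + h)) ℂ) =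
      (∑ c, C (b c) * X (Fin.natAdd h c)) ^ 1 := (pow_one _).symm
  rw [coeff_sub, coeff_add, coeff_sub, e1, coeff_linY_pow b 0 W, e2, ← pow_mul, ← pow_mul,
    coeff_linY_pow b 1 W, coeff_linY_pow b (1 * 2) W, coeff_linY_pow b (1 * 3) W]
  rcases Nat.lt_or_ge W.card 1 with h0 | h1
  · have : W.card = 0 := by omega
    simp [this]
  rcases Nat.lt_or_ge W.card 2 with h1' | h2
  · have : W.card = 1 := by omega
    simp [this]
  rcases Nat.lt_or_ge W.card 3 with h2' | h3
  · have : W.card = 2 := by omega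
    simp [this]
  · have : W.card = 3 := by omega
    simp [this]
    norm_num

/-! ## 2. The starved design -/

/-- `x`-coefficient table of the design: the vertex form `a` carries `x_a`; the pair form of the 3-column `j` carries
`x_{α j} + x_{β j}`. -/
def desA (w : Fin r → Finset (Fin h)) (α β : {j : Fin r // (w j).card = 3} → Fin h) :
    (Fin h ⊕ {j : Fin r // (w j).card = 3}) → Fin h → ℂ
  | Sum.inl a, a' => if a' = a then 1 else 0
  | Sum.inr j, a' => if a' = α j ∨ a' = β j then 1 else 0

/-- `y`-coefficient table of the design: the vertex form `a` carries `y_a`; the pair form of `j` carries `Σ_{c ∈ w j} y_c`. -/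
def desB (w : Fin r → Finset (Fin h)) : (Fin h ⊕ {j : Fin r // (w j).card = 3}) → Fin h → ℂ
  | Sum.inl a, c => if c = a then 1 else 0
  | Sum.inr j, c => if c ∈ w j.1 then 1 else 0

/-- The incidence count `inc v W = #{j : v ∈ {α j, β j} ∧ W ⊆ w j}`. -/
def inc (w : Fin r → Finset (Fin h)) (α β : {j : Fin r // (w j).card = 3} → Fin h) (v : Fin h)
    (W : Finset (Fin h)) : ℕ :=
  (Finset.univ.filter fun j : {j : Fin r // (w j).card = 3} => (v = α j ∨ v = β j) ∧ W ⊆ w j.1).card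

/-- Coefficients of the truncated inverse of an INDICATOR form `1 − Y_S + Y_S² − Y_S³`: `(−1)^{|W|} |W|! [W ⊆ S]`. -/
theorem coeff_tinv_indicator (S W : Finset (Fin h)) (hW : W.card ≤ 3) :
    coeff (∑ a' ∈ (∅ : Finset (Fin h)), Finsupp.single (Fin.castAdd h a') 1 +
        ∑ c ∈ W, Finsupp.single (Fin.natAdd h c) 1)
        (1 - (∑ c, C (if c ∈ S then (1 : ℂ) else 0) * X (Fin.natAdd h c)) +
            (∑ c, C (if c ∈ S then (1 : ℂ) else 0) * X (Fin.natAdd h c)) ^ 2 -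
          (∑ c, C (if c ∈ S then (1 : ℂ) else 0) * X (Fin.natAdd h c)) ^ 3 : MvPolynomial (Fin (h + h)) ℂ) =
      (-1) ^ W.card * (W.card.factorial : ℂ) * (if W ⊆ S then 1 else 0) := by
  rw [coeff_tinv_lin (fun c => if c ∈ S then (1 : ℂ) else 0) W hW, Finset.prod_boole]
  congr 1

/-- The `y`-part of a vertex form is the indicator form of `{a}`. -/
theorem linY_desB_inl (w : Fin r → Finset (Fin h)) (a : Fin h) :
    linY (desB w) (Sum.inl a) = ∑ c, C (if c ∈ ({a} : Finset (Fin h)) then (1 : ℂ) else 0) * X (Fin.natAdd h c) := by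
  unfold linY
  refine Finset.sum_congr rfl fun c _ => ?_
  simp only [desB, Finset.mem_singleton]

/-- The `y`-part of the pair form of a 3-column `j` is the indicator form of `w j`. -/
theorem linY_desB_inr (w : Fin r → Finset (Fin h)) (j : {j : Fin r // (w j).card = 3}) :
    linY (desB w) (Sum.inr j) = ∑ c, C (if c ∈ w j.1 then (1 : ℂ) else 0) * X (Fin.natAdd h c) := by
  unfold linY
  rfl

/-- Coefficients of `t_{inl a}`. -/
theorem coeff_tinv_inl (w : Fin r → Finset (Fin h)) (a : Fin h) (W : Finset (Fin h)) (hW : W.card ≤ 3) :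
    coeff (∑ a' ∈ (∅ : Finset (Fin h)), Finsupp.single (Fin.castAdd h a') 1 +
        ∑ c ∈ W, Finsupp.single (Fin.natAdd h c) 1) (tinv (desB w) (Sum.inl a)) =
      (-1) ^ W.card * (W.card.factorial : ℂ) * (if W ⊆ {a} then 1 else 0) := by
  unfold tinv
  rw [linY_desB_inl]
  exact coeff_tinv_indicator {a} W hW

/-- Coefficients of `t_{inr j}`. -/
theorem coeff_tinv_inr (w : Fin r → Finset (Fin h)) (j : {j : Fin r // (w j).card = 3}) (W : Finset (Fin h))
    (hW : W.card ≤ 3) :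
    coeff (∑ a' ∈ (∅ : Finset (Fin h)), Finsupp.single (Fin.castAdd h a') 1 +
        ∑ c ∈ W, Finsupp.single (Fin.natAdd h c) 1) (tinv (desB w) (Sum.inr j)) =
      (-1) ^ W.card * (W.card.factorial : ℂ) * (if W ⊆ w j.1 then 1 else 0) := by
  unfold tinv
  rw [linY_desB_inr]
  exact coeff_tinv_indicator (w j.1) W hW

/-- `ρ̂₁ v` of the design: the vertex inverse plus the inverses of the pair forms through `v`. -/
theorem rho1_des (w : Fin r → Finset (Fin h)) (α β : {j : Fin r // (w j).card = 3} → Fin h) (v : Fin h) :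
    rho1 (desA w α β) (desB w) Finset.univ v =
      tinv (desB w) (Sum.inl v) +
        ∑ j ∈ Finset.univ.filter (fun j : {j : Fin r // (w j).card = 3} => v = α j ∨ v = β j),
          tinv (desB w) (Sum.inr j) := by
  classical
  unfold rho1
  rw [Fintype.sum_sum_type]
  congr 1
  · have e : ∀ a : Fin h, C (desA w α β (Sum.inl a) v) * tinv (desB w) (Sum.inl a) =
        if v = a then tinv (desB w) (Sum.inl a) else 0 := by
      intro a
      simp only [desA]
      split_ifs <;> simp
    simp_rw [e]
    rw [Finset.sum_ite_eq Finset.univ v, if_pos (Finset.mem_univ _)]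
  · rw [Finset.sum_filter]
    refine Finset.sum_congr rfl fun j _ => ?_
    simp only [desA]
    split_ifs <;> simp

/-- **Coefficient table of `ρ̂₁ v` for the design**: for `|W| ≤ 3`,
`coeff (E ∅ W) (ρ̂₁ v) = (−1)^{|W|} |W|! · ([W ⊆ {v}] + inc v W)`. -/
theorem coeff_rho1_des (w : Fin r → Finset (Fin h)) (α β : {j : Fin r // (w j).card = 3} → Fin h) (v : Fin h)
    (W : Finset (Fin h)) (hW : W.card ≤ 3) :
    coeff (∑ a' ∈ (∅ : Finset (Fin h)), Finsupp.single (Fin.castAdd h a') 1 +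
        ∑ c ∈ W, Finsupp.single (Fin.natAdd h c) 1) (rho1 (desA w α β) (desB w) Finset.univ v) =
      (-1) ^ W.card * (W.card.factorial : ℂ) * ((if W ⊆ {v} then 1 else 0) + (inc w α β v W : ℂ)) := by
  classical
  rw [rho1_des, coeff_add, coeff_sum, coeff_tinv_inl w v W hW]
  simp_rw [coeff_tinv_inr w _ W hW]
  rw [← Finset.mul_sum, ← mul_add]
  congr 1
  congr 1
  unfold inc
  rw [Finset.sum_boole, Finset.filter_filter]

/-- `ρ̂₂ = ρ̂₁ · ρ̂₁ −` (same-form correction). -/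
theorem rho2_eq {ι : Type*} [DecidableEq ι] (A B : ι → Fin h → ℂ) (K : Finset ι) (a b : Fin h) :
    rho2 A B K a b = rho1 A B K a * rho1 A B K b - ∑ k ∈ K, C (A k a * A k b) * (tinv B k * tinv B k) := by
  unfold rho2 rho1
  rw [Finset.sum_mul_sum, ← Finset.sum_sub_distrib]
  refine Finset.sum_congr rfl fun k hk => ?_
  rw [← Finset.sum_erase_add K _ hk, add_sub_assoc]
  have e : C (A k a) * tinv B k * (C (A k b) * tinv B k) - C (A k a * A k b) * (tinv B k * tinv B k) = 0 := by
    rw [C_mul]; ring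
  rw [e, add_zero]
  refine Finset.sum_congr rfl fun k' _ => ?_
  rw [C_mul]; ring

/-- The same-form correction of the design at `{a, b}` (`a ≠ b`): only the pair forms `j` with `{α j, β j} = {a, b}`
contribute, each `t_j²`. -/
theorem corr_des (w : Fin r → Finset (Fin h)) (α β : {j : Fin r // (w j).card = 3} → Fin h) (a b : Fin h)
    (hab : a ≠ b) :
    ∑ k, C (desA w α β k a * desA w α β k b) * (tinv (desB w) k * tinv (desB w) k) =
      ∑ j ∈ Finset.univ.filter (fun j : {j : Fin r // (w j).card = 3} =>
          (a = α j ∨ a = β j) ∧ (b = α j ∨ b = β j)),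
        tinv (desB w) (Sum.inr j) * tinv (desB w) (Sum.inr j) := by
  classical
  rw [Fintype.sum_sum_type]
  have e0 : ∑ a' : Fin h, C (desA w α β (Sum.inl a') a * desA w α β (Sum.inl a') b) *
      (tinv (desB w) (Sum.inl a') * tinv (desB w) (Sum.inl a')) = 0 := by
    refine Finset.sum_eq_zero fun a' _ => ?_
    simp only [desA]
    split_ifs with h1 h2 <;> simp
    exact absurd (h1.trans h2.symm) hab
  rw [e0, zero_add, Finset.sum_filter]
  refine Finset.sum_congr rfl fun j _ => ?_
  simp only [desA]
  split_ifs <;> simp_all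

end

end Summit.ValiantsHypothesis.ValiantsHypothesis.Theorems.BarrierLever.ChowStarvedDesign
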